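import Summits.BirchSwinnertonDyer.Rank1Residual.Additive.GordCycLowerBound
import Literature.NumberTheory.EllipticCurves.Delbourgo2002.PAdicBSDLeadingTermIntrinsic
import HarnessLib

/-!
# O7-ord / N10, the LOWER half in Iwasawa currency through Delbourgo 2002 Thm. (B) with the
# `ℓ`-invariant INTRINSIC: the consumer of `CycLowerBoundAt` without the non-anomalous hypothesis
# (cell `bsd-addord`, seat `bsd-addord-twist`; T-ANOM route R1, item (T4) glue)

HONEST FRAMING (cell `bsd-addord`, `run/shared/lean/pub/bsd-addord/README.md` §4): the programme's
target of record is the full Birch–Swinnerton-Dyer formula for every `E/ℚ` of analytic rank `≤ 1`;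
nothing is booked here. Theorems only; NO named fact is minted: Delbourgo 2002 Thm. (B) enters ONLY
through its INTRINSIC clause predicate `Delbourgo2002.LeadingTermClausesIntrinsic W p Dh`
(`Literature/…/Delbourgo2002/PAdicBSDLeadingTermIntrinsic.lean`, p404293, referee conditions
(c1)–(c5) of `REF-tanom.md`): clause 3 carries the factor `ι / c_p`,
`ι = [E(ℚ_p) : N_∞E(ℚ_p)]` = `localUniversalNormIndex (v.adicCompletion ℚ) κ ⊤`, together with the
printed finiteness `0 < ι`, in place of the sibling's `ℓ ∣ p²`, `ℓ = 1` off the anomalous rows.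

## What and why

The sibling file `GordCycLowerBound.lean` (team n1011) proves: Delbourgo (B) in the `ℓ`-currency +
the typed input `CycLowerBoundAt W p Dh` ⟹ `ord_p #Ш_an ≤ ord_p #Ш + ord_p ℓ`, and the lower half
`Typed.MissingLowerBoundAt W p` on the NON-ANOMALOUS rows (`ℓ = 1`). Here the same bookkeeping is run
against the intrinsic clauses: `ord_p #Ш_an ≤ ord_p #Ш + ord_p ι − ord_p c_p`
(`exists_shaAn_padicValRat_le_of_cycLowerBound_intrinsic`), so that the lower half follows from
**`p ∤ ι`** (`missingLowerBoundAt_of_cycLowerBound_of_not_dvd_index`) — which the twist transport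
(T3) supplies on EVERY additive potentially-good-ordinary row of defect `2`, anomalous or not
(`UniversalNormTwist.not_dvd_localUniversalNormIndex_of_goodOrd_twist`,
`Additive/UniversalNormTwistTransportRat.lean`, from Mazur 1972 Cor. 5.15 by name). This is the kernel
replacement for the binder `hna : ReductionNonAnomalous W p` of the rank-`1` end states
(`TwistedBranchPAdicGrossZagierEndState.lean`); the remaining input of those end states in the
intrinsic currency is the cell fact `delbourgoDatum_rankOne_leadingTerms` restated with
`LeadingTermClausesIntrinsic` (seat `bsd-addord-gz`). Mechanism: with `#Ш_an = s = q·#tors²/∏c_ℓ`,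
clause 3 and the typed input give `c · q · #tors² · Reg_p = u · (ι/c_p) · #Ш[p^∞] · Reg_p · ∏c_ℓ`
(`c ∈ ℤ_p`, `u ∈ ℤ_p^×`); cancel `Reg_p ≠ 0` and take valuations.

References: D. Delbourgo, J. Number Theory 95 (2002) 38–71, Theorem (B) p. 40, p. 67 (iv), p. 69
[Delbourgo2002]; R. L. Miller, LMS J. Comput. Math. 14 (2011) Def. 1.1 [Miller2011LMS]; B. Mazur,
Invent. Math. 18 (1972) Cor. 5.15 [Mazur1972Towers].
-/

noncomputable section

open scoped Classical NumberField

open WeierstrassCurve NumberField Literature.NumberTheory.EllipticCurves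
  Literature.NumberTheory.EllipticCurves.Rank1Residual
  Literature.NumberTheory.EllipticCurves.Rank1Residual.Typed
  Literature.NumberTheory.EllipticCurves.Delbourgo2002
  IsDedekindDomain

namespace Summit.BirchSwinnertonDyer.Rank1Residual.Additive

variable (W : WeierstrassCurve ℚ) [W.IsElliptic] (p : ℕ) [hp : Fact p.Prime]

/-- **CORE (class-agnostic, any rank `r_an ≤ 1`), intrinsic currency.** Let `Dh` be a `p`-adic height
datum for which Delbourgo 2002 Thm. (B) holds with the `ℓ`-invariant intrinsic
(`hB : LeadingTermClausesIntrinsic W p Dh`) and non-degenerate regulator (`hS`), `X(E/ℚ_∞)` `Λ`-torsion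
for every datum (`hA`), Gross–Zagier–Kolyvagin (`hGZK`), `v` the place above `p` with `c_p ≠ 0`
(`hcp`; automatic, e.g. `tamagawaNumberAt_ne_zero_and_le_four_of_addv` on additive rows). Then the typed input
`CycLowerBoundAt W p Dh` yields `#Ш_an(E) = s ∈ ℚ` with, for the cyclotomic `κ` produced by the tree,
`ι = [E(ℚ_p) : N_∞E(ℚ_p)] > 0` and **`ord_p s + ord_p c_p ≤ ord_p #Ш(E) + ord_p ι`**.
[cite: Delbourgo2002, Theorem (B) (p. 40) with p. 67 (iv), p. 69] [cite: Miller2011LMS, Def. 1.1] -/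
theorem exists_shaAn_padicValRat_le_of_cycLowerBound_intrinsic {Dh : PAdicHeightData W p}
    (hB : LeadingTermClausesIntrinsic W p Dh) (hS : SchneiderConjecture Dh)
    (hA : ∀ (κ : ZpExtension ℚ p) (γ : Field.absoluteGaloisGroup ℚ),
      κ.IsCyclotomic → κ.IsTopGenerator γ → ∀ D : W.SelmerDualData κ γ, D.IsTorsion)
    (hGZK : rank_eq_analyticRank_of_analyticRank_le_one) (hr : W.analyticRank ≤ 1)
    (v : HeightOneSpectrum (𝓞 ℚ)) (hv : (p : 𝓞 ℚ) ∈ v.asIdeal) (hcp : W.tamagawaNumberAt v ≠ 0)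
    (hlow : CycLowerBoundAt W p Dh) :
    ∃ (s : ℚ) (κ : ZpExtension ℚ p), κ.IsCyclotomic ∧ shaAn W = (s : ℂ) ∧
      0 < localUniversalNormIndex (W := W) (v.adicCompletion ℚ) κ ⊤ ∧
      padicValRat p s + padicValNat p (W.tamagawaNumberAt v) ≤
        (padicValNat p W.shaOrder : ℤ) +
          padicValNat p (localUniversalNormIndex (W := W) (v.adicCompletion ℚ) κ ⊤) := by
  have hpP : p.Prime := hp.out
  -- Gross–Zagier–Kolyvagin: `Ш` finite
  obtain ⟨-, hfin⟩ := hGZK W hr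
  haveI : Finite W.sha := hfin
  have hfinp : Finite (AddCommGroup.primaryComponent W.sha p) := inferInstance
  -- the cyclotomic setting, a dual datum, a generator of the characteristic ideal
  obtain ⟨κ, hκ, γ, hγ, hγ'⟩ := exists_isCyclotomic_isTopGenerator_isCyclotomicVariable_holds p
  obtain ⟨D⟩ := W.nonempty_selmerDualData_holds κ γ hγ
  haveI : Module.Finite (IwasawaAlgebra p) D.X := D.module_finite_holds hγ
  haveI : (Module.charIdeal (IwasawaAlgebra p) D.X).IsPrincipal := charIdeal_isPrincipal_holds p D.X
  obtain ⟨fE, hchar⟩ := Submodule.IsPrincipal.principal (Module.charIdeal (IwasawaAlgebra p) D.X)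
  have hchar' : D.charIdeal = Ideal.span {fE} := hchar
  have hX : D.IsTorsion := hA κ γ hκ hγ D
  -- Delbourgo 2002 (B), clause 3, intrinsic currency
  obtain ⟨hιpos, u, hBeq⟩ := (hB κ γ hκ hγ hγ' D hX fE hchar' v hv).2.2 hS hfinp
  -- the typed input
  obtain ⟨q, c, hlead, hlowEq⟩ := hlow κ γ hκ hγ hγ' D fE hchar'
  -- abbreviations in `ℚ_p`
  set r := W.mordellWeilRank with hr_def
  set ι : ℕ := localUniversalNormIndex (W := W) (v.adicCompletion ℚ) κ ⊤ with hι_def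
  set A : ℚ_[p] := ((PowerSeries.coeff r fE : ℤ_[p]) : ℚ_[p]) *
    padicLog p (cyclotomicGenerator p) ^ r with hA_def
  set T2 : ℚ_[p] := (W.torsionOrder : ℚ_[p]) ^ 2 with hT2_def
  set Shp : ℚ_[p] := (Nat.card (AddCommGroup.primaryComponent W.sha p) : ℚ_[p]) with hShp_def
  set Rg : ℚ_[p] := padicRegulator Dh with hRg_def
  set Cc : ℚ_[p] := (W.tamagawaProduct : ℚ_[p]) with hCc_def
  set Cp : ℚ_[p] := (W.tamagawaNumberAt v : ℚ_[p]) with hCp_def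
  set cQ : ℚ_[p] := ((c : ℤ_[p]) : ℚ_[p]) with hcQ_def
  set uQ : ℚ_[p] := ((u : ℤ_[p]) : ℚ_[p]) with huQ_def
  -- non-vanishing
  have hu0 : uQ ≠ 0 := coe_units_ne_zero p u
  have hι0 : (ι : ℚ_[p]) ≠ 0 := by exact_mod_cast hιpos.ne'
  have hShp0 : Shp ≠ 0 := by rw [hShp_def]; exact_mod_cast Nat.card_pos.ne'
  have hCc0 : Cc ≠ 0 := by
    rw [hCc_def]; exact_mod_cast (W.tamagawaProduct_pos_holds : 0 < W.tamagawaProduct).ne'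
  have hCp0 : Cp ≠ 0 := by rw [hCp_def]; exact_mod_cast hcp
  have hT0 : W.torsionOrder ≠ 0 := (W.torsionOrder_pos_holds).ne'
  have hT2 : T2 ≠ 0 := by rw [hT2_def]; exact pow_ne_zero 2 (by exact_mod_cast hT0)
  have hRg0 : Rg ≠ 0 := hS
  -- `c · q · T2 · Cp · Rg = u · ι · Shp · Cc · Rg`
  have key : cQ * (q : ℚ_[p]) * T2 * Cp * Rg = uQ * (ι : ℚ_[p]) * Shp * Cc * Rg := by
    calc cQ * (q : ℚ_[p]) * T2 * Cp * Rg = (cQ * (q : ℚ_[p]) * Rg) * T2 * Cp := by ring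
      _ = A * T2 * Cp := by rw [← hlowEq]
      _ = uQ * ((ι : ℚ_[p]) / Cp) * (Shp * Rg * Cc) * Cp := by rw [hA_def, hBeq]
      _ = uQ * (ι : ℚ_[p]) * Shp * Cc * Rg := by field_simp
  have key2 : cQ * (q : ℚ_[p]) * T2 * Cp = uQ * (ι : ℚ_[p]) * Shp * Cc :=
    mul_right_cancel₀ hRg0 key
  have hrhs : uQ * (ι : ℚ_[p]) * Shp * Cc ≠ 0 :=
    mul_ne_zero (mul_ne_zero (mul_ne_zero hu0 hι0) hShp0) hCc0
  have hlhs : cQ * (q : ℚ_[p]) * T2 * Cp ≠ 0 := by rw [key2]; exact hrhs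
  have hc0 : cQ ≠ 0 := fun h ↦ hlhs (by rw [h]; ring)
  have hqQ : ((q : ℚ) : ℚ_[p]) ≠ 0 := fun h ↦ hlhs (by rw [h]; ring)
  have hq0 : q ≠ 0 := fun h ↦ hqQ (by rw [h, Rat.cast_zero])
  -- valuations
  have hval := congrArg Padic.valuation key2
  rw [Padic.valuation_mul (mul_ne_zero (mul_ne_zero hc0 hqQ) hT2) hCp0,
    Padic.valuation_mul (mul_ne_zero hc0 hqQ) hT2, Padic.valuation_mul hc0 hqQ,
    Padic.valuation_mul (mul_ne_zero (mul_ne_zero hu0 hι0) hShp0) hCc0,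
    Padic.valuation_mul (mul_ne_zero hu0 hι0) hShp0, Padic.valuation_mul hu0 hι0,
    huQ_def, valuation_coe_units_eq_zero, zero_add, Padic.valuation_ratCast, hT2_def,
    Padic.valuation_pow, Padic.valuation_natCast, hCp_def, Padic.valuation_natCast,
    Padic.valuation_natCast, hShp_def, Padic.valuation_natCast, padicValNat_card_addPrimaryComponent,
    hCc_def, Padic.valuation_natCast] at hval
  have hcnn : 0 ≤ cQ.valuation := PadicInt.valuation_coe_nonneg
  -- the analytic order of `Ш`
  set s : ℚ := q * (W.torsionOrder : ℚ) ^ 2 / (W.tamagawaProduct : ℚ) with hs_def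
  refine ⟨s, κ, hκ, shaAn_eq_of_leadingLCoeff_eq W hlead, hιpos, ?_⟩
  have hTq : (W.torsionOrder : ℚ) ≠ 0 := by exact_mod_cast hT0
  have hPq : (W.tamagawaProduct : ℚ) ≠ 0 := by
    exact_mod_cast (W.tamagawaProduct_pos_holds : 0 < W.tamagawaProduct).ne'
  rw [hs_def, padicValRat.div (mul_ne_zero hq0 (pow_ne_zero 2 hTq)) hPq,
    padicValRat.mul hq0 (pow_ne_zero 2 hTq), padicValRat.pow, padicValRat.of_nat,
    padicValRat.of_nat, WeierstrassCurve.shaOrder]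
  push_cast at hval ⊢
  linarith

/-- **The lower half from `p ∤ [E(ℚ_p) : N_∞E(ℚ_p)]`.** In the setting of
`exists_shaAn_padicValRat_le_of_cycLowerBound_intrinsic`, if the universal-norm index of `E(ℚ_p)`
along the cyclotomic tower is prime to `p` whenever it is finite (the twist-transport theorem
`UniversalNormTwist.not_dvd_localUniversalNormIndex_of_goodOrd_twist` on every additive
potentially-good-ordinary row of defect `2`, anomalous or not), the typed input gives
`Typed.MissingLowerBoundAt W p` (`ord_p #Ш_an ≤ ord_p #Ш`) — the non-anomalous hypothesis of
`missingLowerBoundAt_of_cycLowerBound` is not needed. [cite: Delbourgo2002, Theorem (B) (p. 40), p. 67 (iv), p. 69]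
[cite: Miller2011LMS, Def. 1.1] -/
theorem missingLowerBoundAt_of_cycLowerBound_of_not_dvd_index {Dh : PAdicHeightData W p}
    (hB : LeadingTermClausesIntrinsic W p Dh) (hS : SchneiderConjecture Dh)
    (hA : ∀ (κ : ZpExtension ℚ p) (γ : Field.absoluteGaloisGroup ℚ),
      κ.IsCyclotomic → κ.IsTopGenerator γ → ∀ D : W.SelmerDualData κ γ, D.IsTorsion)
    (hGZK : rank_eq_analyticRank_of_analyticRank_le_one) (hr : W.analyticRank ≤ 1)
    (v : HeightOneSpectrum (𝓞 ℚ)) (hv : (p : 𝓞 ℚ) ∈ v.asIdeal) (hcp : W.tamagawaNumberAt v ≠ 0)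
    (hι : ∀ κ : ZpExtension ℚ p, κ.IsCyclotomic →
      localUniversalNormIndex (W := W) (v.adicCompletion ℚ) κ ⊤ ≠ 0 →
      ¬ p ∣ localUniversalNormIndex (W := W) (v.adicCompletion ℚ) κ ⊤)
    (hlow : CycLowerBoundAt W p Dh) :
    MissingLowerBoundAt W p := by
  obtain ⟨s, κ, hκ, hs, hιpos, hle⟩ :=
    exists_shaAn_padicValRat_le_of_cycLowerBound_intrinsic W p hB hS hA hGZK hr v hv hcp hlow
  refine ⟨s, hs, ?_⟩
  have hι0 : padicValNat p (localUniversalNormIndex (W := W) (v.adicCompletion ℚ) κ ⊤) = 0 :=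
    padicValNat.eq_zero_of_not_dvd (hι κ hκ hιpos.ne')
  rw [hι0, Nat.cast_zero, add_zero] at hle
  have h0 : (0 : ℤ) ≤ (padicValNat p (W.tamagawaNumberAt v) : ℤ) := Nat.cast_nonneg _
  linarith

end Summit.BirchSwinnertonDyer.Rank1Residual.Additive

end
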